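import Summits.AtomisticToContinuum.HydrodynamicLimit.Theorems.LambertianContactSwapLambertianEulerProductionSplitTools
import Summits.AtomisticToContinuum.HydrodynamicLimit.Theorems.OneFlightGossipEngineClampedCurrentsDockCancellation
import Summits.AtomisticToContinuum.HydrodynamicLimit.Theorems.OneFlightGossipEngineClampedCurrentsDockEos
import HarnessLib

/-!
# The streaming term of the window production splits into the fast kinetic current and the
# collisional counter-terms along the Lambertian gas
# (crux `LambertianEuler`, stmt-AtomisticToContinuum-11854, line `Sketch`, stub `stub_productionSplitLambda`)

Helper file (`--supports`) of the crux
`Summit.AtomisticToContinuum.HydrodynamicLimit.Theses.LambertianContactSwap.LambertianEuler`, line `Sketch`,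
registered stub B2 `stub_productionSplitLambda`. Along the reference activity `a = ρ·Rf(σ³ρ)` of a classical
hs-Euler solution inside the analyticity band of the equation of state, the streaming rate of the local Gibbs
exponent is POINTWISE the fast kinetic current minus the collisional counter-terms,
`Dg_r(x, v) = Y⊥_r(x, v) − X_r(x, v)` on `[0, T)` (the tree's Euler cancellation
`ClampedCurrentsDockCancellation.stub_cancellation` fed with the EOS consistency
`ClampedCurrentsDockEos.stub_eos`); summed over the particles, integrated over a window `[s, s′] ⊆ [0, T)`
and averaged under local Gibbs data ⊗ Lambertian noise this gives
`E_λ[∫_s^{s′} Σ_i Dg] = E_λ[∫_s^{s′} Σ_i Y⊥] − E_λ[∫_s^{s′} Σ_i X]`, both window functionals being integrable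
(`…ProductionSplitTools.integrable_window_functional`: `Y⊥, X` clamped to the window are continuous in `(r, x, v)`
— derivatives of jointly smooth fields are jointly smooth, `Z, Z′` are continuous on the band where `Z = 1 + ηF′` —,
grow at most cubically in `v` uniformly on the window, the Lambertian flow is jointly measurable and does not
increase the kinetic energy, and the local Gibbs law has Gaussian velocity moments).

References: H.-T. Yau, Lett. Math. Phys. 22 (1991) §2 (bookkeeping of the relative-entropy method);
measure theory otherwise.
-/

noncomputable section

namespace Summit.AtomisticToContinuum.HydrodynamicLimit.Theorems.LambertianContactSwapLambertianEulerProductionSplit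

open scoped BigOperators Topology ENNReal InnerProductSpace
open MeasureTheory ProbabilityTheory Filter Set InformationTheory
open Literature.MathematicalPhysics.KineticTheory
open Literature.Analysis.FluidPDE Literature.Analysis.FluidPDE.Alexander
open Literature.Analysis.FunctionSpaces
open Summit.AtomisticToContinuum.HydrodynamicLimit.Theorems.ClampedCurrentsDockPathwise (gExp DgExp gSum DgSum)
open Summit.AtomisticToContinuum.HydrodynamicLimit.Theorems.LambertianContactSwapLambertianEulerProductionSplitTools

/-! ## The stub -/

section Stub

/-- **STUB `stub_productionSplitLambda`** (B2) of line `Sketch` (crux `LambertianEuler`, stmt-AtomisticToContinuum-11854).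
**The streaming term of the FORMULA splits into the fast kinetic current and the collisional counter-terms, along
`Λ`, at fixed `N`.** For an insertion factor `Rf` with the four properties of `stub_eosRatioAnalytic` there is a band
`ηb > 0` (the `η₁` of `ClampedCurrentsDockEos.stub_eos`) such that for `0 < σ < 1/2`, continuous positive data
profiles, every `T, N, Φ`, every classical hs-Euler solution on `[0,T)` with packing `ρσ³ < ηb` throughout, and
`0 ≤ s ≤ s′ < T`: the windowed functionals `E_λ[∫_s^{s′} Σ_i Y⊥]` and `E_λ[∫_s^{s′} Σ_i X]` along `Λ` are
`λ_N ⊗ γ^ℕ`-integrable and `E_λ[∫_s^{s′} Σ_i Dg_r(Λ_r) dr] = E_λ[∫ Σ Y⊥] − E_λ[∫ Σ X]` for the activity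
`a = ρ·Rf(σ³ρ)`. Proof: POINTWISE `Dg_r(x,v) = Y⊥_r(x,v) − X_r(x,v)` for `r ∈ [0,T)` is
`ClampedCurrentsDockCancellation.stub_cancellation` (`EulerCancellation`) fed with `(η₁, F)` from
`ClampedCurrentsDockEos.stub_eos` (`Z = 1 + ηF′` on `(0,η₁)` by `Filter.EventuallyEq.deriv_eq`, `0 < Rf` from the
functional equation); then linearity of `∫_s^{s′}` and of `E_λ` once both pieces are integrable
(`integrable_window_functional`: the clamped currents are continuous in `(r, x, v)` — derivatives of jointly smooth
fields are jointly smooth, `Z, Z′` continuous on the band —, of cubic growth in `v` uniformly on the window, `Λ` is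
jointly measurable and does not increase the energy, Gaussian moments of `λ_N`). [cite: Yau1991, §2] -/
theorem stub_productionSplitLambda :
    ∀ (r : ℝ) (Rf : ℝ → ℝ), 0 < r →
      (∀ x ∈ Set.Ioo (-r) r, 0 < Rf x ∧ Rf x * (∑' j : ℕ, bE j / (j.factorial : ℝ) * (x * Rf x) ^ j) = 1) →
      (∀ x ∈ Set.Icc 0 r, 1 ≤ Rf x ∧ Rf x ≤ 2) → ContinuousOn Rf (Set.Icc 0 r) →
      (∀ x ∈ Set.Ioo (-r) r, ∀ R ∈ Set.Icc (1 / 2 : ℝ) 2,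
        R * (∑' j : ℕ, bE j / (j.factorial : ℝ) * (x * R) ^ j) = 1 → R = Rf x) →
    ∃ ηb : ℝ, 0 < ηb ∧ ∀ {σ : ℝ}, 0 < σ → σ < 2⁻¹ → ∀ {a₀ θ₀ : T3 → ℝ} {u₀ : T3 → V3},
      Continuous a₀ → Continuous θ₀ → Continuous u₀ → (∀ x, 0 < a₀ x) → (∀ x, 0 < θ₀ x) →
      ∀ (T : ℝ) (N : ℕ) (Φ : HardSphereFlow (Torus.geometry (Fin 3)) (hsDiameter σ N) (N + 1))
        (ρ θ : ℝ → T3 → ℝ) (u : ℝ → T3 → V3), IsHardSphereEulerSolution σ T ρ u θ →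
        (∀ t ∈ Set.Ico 0 T, ∀ x, ρ t x * σ ^ 3 < ηb) →
        ∀ (s s' : ℝ), 0 ≤ s → s ≤ s' → s' < T →
          Integrable (fun p : Config (N + 1) (Fin 3) T3 × (ℕ → V3) =>
              ∫ r in s..s', ∑ i : Fin (N + 1), ((θ r (lambertFlow (Torus.geometry (Fin 3)) (hsDiameter σ N) p.2 p.1 r i).1)⁻¹ * ∑ j : Fin 3, ∑ k : Fin 3, (((lambertFlow (Torus.geometry (Fin 3)) (hsDiameter σ N) p.2 p.1 r i).2 - u r (lambertFlow (Torus.geometry (Fin 3)) (hsDiameter σ N) p.2 p.1 r i).1) j * ((lambertFlow (Torus.geometry (Fin 3)) (hsDiameter σ N) p.2 p.1 r i).2 - u r (lambertFlow (Torus.geometry (Fin 3)) (hsDiameter σ N) p.2 p.1 r i).1) k - (if j = k then ‖(lambertFlow (Torus.geometry (Fin 3)) (hsDiameter σ N) p.2 p.1 r i).2 - u r (lambertFlow (Torus.geometry (Fin 3)) (hsDiameter σ N) p.2 p.1 r i).1‖ ^ 2 / 3 else 0)) * Literature.Analysis.FunctionSpaces.Torus.partialDeriv k (fun y => u r y j)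 (lambertFlow (Torus.geometry (Fin 3)) (hsDiameter σ N) p.2 p.1 r i).1 + (‖(lambertFlow (Torus.geometry (Fin 3)) (hsDiameter σ N) p.2 p.1 r i).2 - u r (lambertFlow (Torus.geometry (Fin 3)) (hsDiameter σ N) p.2 p.1 r i).1‖ ^ 2 - 5 * θ r (lambertFlow (Torus.geometry (Fin 3)) (hsDiameter σ N) p.2 p.1 r i).1) * (∑ k : Fin 3, ((lambertFlow (Torus.geometry (Fin 3)) (hsDiameter σ N) p.2 p.1 r i).2 - u r (lambertFlow (Torus.geometry (Fin 3)) (hsDiameter σ N) p.2 p.1 r i).1) k * Literature.Analysis.FunctionSpaces.Torus.partialDeriv k (θ r) (lambertFlow (Torus.geometry (Fin 3)) (hsDiameter σ N) p.2 p.1 r i).1) / (2 * (θ r (lambertFlow (Torus.geometry (Fin 3)) (hsDiameter σ N) p.2 p.1 r i).1) ^ 2))) ((localGibbsLaw σ a₀ u₀ θ₀ N Φ).prod (lambertNoise (Fin 3))) ∧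
          Integrable (fun p : Config (N + 1) (Fin 3) T3 × (ℕ → V3) =>
              ∫ r in s..s', ∑ i : Fin (N + 1), ((∑ k : Fin 3, Literature.Analysis.FunctionSpaces.Torus.partialDeriv k (fun y => u r y k / θ r y) (lambertFlow (Torus.geometry (Fin 3)) (hsDiameter σ N) p.2 p.1 r i).1) * (θ r (lambertFlow (Torus.geometry (Fin 3)) (hsDiameter σ N) p.2 p.1 r i).1 * (ρ r (lambertFlow (Torus.geometry (Fin 3)) (hsDiameter σ N) p.2 p.1 r i).1 * σ ^ 3) * deriv hsCompressibility (ρ r (lambertFlow (Torus.geometry (Fin 3)) (hsDiameter σ N) p.2 p.1 r i).1 * σ ^ 3) + (1 / 3) * (hsCompressibility (ρ r (lambertFlow (Torus.geometry (Fin 3)) (hsDiameter σ N) p.2 p.1 r i).1 * σ ^ 3) - 1) * ‖(lambertFlow (Torus.geometry (Fin 3)) (hsDiameter σ N) p.2 p.1 r i).2 - u r (lambertFlow (Torus.geometry (Fin 3)) (hsDiameter σ N) p.2 p.1 r i).1‖ ^ 2) + ((∑ k : Fin 3, u r (lambertFlow (Torus.geometry (Fin 3)) (hsDiameter σ N) p.2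 p.1 r i).1 k * Literature.Analysis.FunctionSpaces.Torus.partialDeriv k (θ r) (lambertFlow (Torus.geometry (Fin 3)) (hsDiameter σ N) p.2 p.1 r i).1) / (θ r (lambertFlow (Torus.geometry (Fin 3)) (hsDiameter σ N) p.2 p.1 r i).1) ^ 2) * (θ r (lambertFlow (Torus.geometry (Fin 3)) (hsDiameter σ N) p.2 p.1 r i).1 * (ρ r (lambertFlow (Torus.geometry (Fin 3)) (hsDiameter σ N) p.2 p.1 r i).1 * σ ^ 3) * deriv hsCompressibility (ρ r (lambertFlow (Torus.geometry (Fin 3)) (hsDiameter σ N) p.2 p.1 r i).1 * σ ^ 3) + (1 / 3) * (hsCompressibility (ρ r (lambertFlow (Torus.geometry (Fin 3)) (hsDiameter σ N) p.2 p.1 r i).1 * σ ^ 3) - 1) * ‖(lambertFlow (Torus.geometry (Fin 3)) (hsDiameter σ N) p.2 p.1 r i).2 - u r (lambertFlow (Torus.geometry (Fin 3)) (hsDiameter σ N) p.2 p.1 r i).1‖ ^ 2) + (hsCompressibility (ρ r (lambertFlow (Torus.geometry (Fin 3)) (hsDiameter σ N) p.2 p.1 r i).1 * σ ^ 3) - 1)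 * (∑ k : Fin 3, ((lambertFlow (Torus.geometry (Fin 3)) (hsDiameter σ N) p.2 p.1 r i).2 - u r (lambertFlow (Torus.geometry (Fin 3)) (hsDiameter σ N) p.2 p.1 r i).1) k * Literature.Analysis.FunctionSpaces.Torus.partialDeriv k (θ r) (lambertFlow (Torus.geometry (Fin 3)) (hsDiameter σ N) p.2 p.1 r i).1) / θ r (lambertFlow (Torus.geometry (Fin 3)) (hsDiameter σ N) p.2 p.1 r i).1)) ((localGibbsLaw σ a₀ u₀ θ₀ N Φ).prod (lambertNoise (Fin 3))) ∧
          (∫ p, (∫ r in s..s', DgSum T (fun r x => ρ r x * Rf (σ ^ 3 * ρ r x)) θ u r (lambertFlow (Torus.geometry (Fin 3)) (hsDiameter σ N) p.2 p.1 r)) ∂((localGibbsLaw σ a₀ u₀ θ₀ N Φ).prod (lambertNoise (Fin 3)))) =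
            (∫ p, (∫ r in s..s', ∑ i : Fin (N + 1), ((θ r (lambertFlow (Torus.geometry (Fin 3)) (hsDiameter σ N) p.2 p.1 r i).1)⁻¹ * ∑ j : Fin 3, ∑ k : Fin 3, (((lambertFlow (Torus.geometry (Fin 3)) (hsDiameter σ N) p.2 p.1 r i).2 - u r (lambertFlow (Torus.geometry (Fin 3)) (hsDiameter σ N) p.2 p.1 r i).1) j * ((lambertFlow (Torus.geometry (Fin 3)) (hsDiameter σ N) p.2 p.1 r i).2 - u r (lambertFlow (Torus.geometry (Fin 3)) (hsDiameter σ N) p.2 p.1 r i).1) k - (if j = k then ‖(lambertFlow (Torus.geometry (Fin 3)) (hsDiameter σ N) p.2 p.1 r i).2 - u r (lambertFlow (Torus.geometry (Fin 3)) (hsDiameter σ N) p.2 p.1 r i).1‖ ^ 2 / 3 else 0)) * Literature.Analysis.FunctionSpaces.Torus.partialDeriv k (fun y => u r y j) (lambertFlow (Torus.geometry (Fin 3)) (hsDiameter σ N) p.2 p.1 r i).1 + (‖(lambertFlow (Torus.geometry (Fin 3)) (hsDiameter σ N) p.2 p.1 r i).2 - u r (lambertFlow (Torus.geometry (Fin 3))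 (hsDiameter σ N) p.2 p.1 r i).1‖ ^ 2 - 5 * θ r (lambertFlow (Torus.geometry (Fin 3)) (hsDiameter σ N) p.2 p.1 r i).1) * (∑ k : Fin 3, ((lambertFlow (Torus.geometry (Fin 3)) (hsDiameter σ N) p.2 p.1 r i).2 - u r (lambertFlow (Torus.geometry (Fin 3)) (hsDiameter σ N) p.2 p.1 r i).1) k * Literature.Analysis.FunctionSpaces.Torus.partialDeriv k (θ r) (lambertFlow (Torus.geometry (Fin 3)) (hsDiameter σ N) p.2 p.1 r i).1) / (2 * (θ r (lambertFlow (Torus.geometry (Fin 3)) (hsDiameter σ N) p.2 p.1 r i).1) ^ 2))) ∂((localGibbsLaw σ a₀ u₀ θ₀ N Φ).prod (lambertNoise (Fin 3)))) -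
              (∫ p, (∫ r in s..s', ∑ i : Fin (N + 1), ((∑ k : Fin 3, Literature.Analysis.FunctionSpaces.Torus.partialDeriv k (fun y => u r y k / θ r y) (lambertFlow (Torus.geometry (Fin 3)) (hsDiameter σ N) p.2 p.1 r i).1) * (θ r (lambertFlow (Torus.geometry (Fin 3)) (hsDiameter σ N) p.2 p.1 r i).1 * (ρ r (lambertFlow (Torus.geometry (Fin 3)) (hsDiameter σ N) p.2 p.1 r i).1 * σ ^ 3) * deriv hsCompressibility (ρ r (lambertFlow (Torus.geometry (Fin 3)) (hsDiameter σ N) p.2 p.1 r i).1 * σ ^ 3) + (1 / 3) * (hsCompressibility (ρ r (lambertFlow (Torus.geometry (Fin 3)) (hsDiameter σ N) p.2 p.1 r i).1 * σ ^ 3) - 1) * ‖(lambertFlow (Torus.geometry (Fin 3)) (hsDiameter σ N) p.2 p.1 r i).2 - u r (lambertFlow (Torus.geometry (Fin 3)) (hsDiameter σ N) p.2 p.1 r i).1‖ ^ 2) + ((∑ k : Fin 3, u r (lambertFlow (Torus.geometry (Fin 3)) (hsDiameter σ N) p.2 p.1 r i).1 k * Literature.Analysis.FunctionSpaces.Torus.partialDeriv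 k (θ r) (lambertFlow (Torus.geometry (Fin 3)) (hsDiameter σ N) p.2 p.1 r i).1) / (θ r (lambertFlow (Torus.geometry (Fin 3)) (hsDiameter σ N) p.2 p.1 r i).1) ^ 2) * (θ r (lambertFlow (Torus.geometry (Fin 3)) (hsDiameter σ N) p.2 p.1 r i).1 * (ρ r (lambertFlow (Torus.geometry (Fin 3)) (hsDiameter σ N) p.2 p.1 r i).1 * σ ^ 3) * deriv hsCompressibility (ρ r (lambertFlow (Torus.geometry (Fin 3)) (hsDiameter σ N) p.2 p.1 r i).1 * σ ^ 3) + (1 / 3) * (hsCompressibility (ρ r (lambertFlow (Torus.geometry (Fin 3)) (hsDiameter σ N) p.2 p.1 r i).1 * σ ^ 3) - 1) * ‖(lambertFlow (Torus.geometry (Fin 3)) (hsDiameter σ N) p.2 p.1 r i).2 - u r (lambertFlow (Torus.geometry (Fin 3)) (hsDiameter σ N) p.2 p.1 r i).1‖ ^ 2) + (hsCompressibility (ρ r (lambertFlow (Torus.geometry (Fin 3)) (hsDiameter σ N) p.2 p.1 r i).1 * σ ^ 3) - 1) * (∑ k : Fin 3, ((lambertFlow (Torus.geometry (Fin 3)) (hsDiameter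 σ N) p.2 p.1 r i).2 - u r (lambertFlow (Torus.geometry (Fin 3)) (hsDiameter σ N) p.2 p.1 r i).1) k * Literature.Analysis.FunctionSpaces.Torus.partialDeriv k (θ r) (lambertFlow (Torus.geometry (Fin 3)) (hsDiameter σ N) p.2 p.1 r i).1) / θ r (lambertFlow (Torus.geometry (Fin 3)) (hsDiameter σ N) p.2 p.1 r i).1)) ∂((localGibbsLaw σ a₀ u₀ θ₀ N Φ).prod (lambertNoise (Fin 3)))) := by
  intro r Rf hr hsol hbd hcont huniq
  obtain ⟨η₁, hη₁, hη₁r, F, hFan, hFeq, hdiff⟩ := ClampedCurrentsDockEos.stub_eos r Rf hr hsol hbd hcont huniq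
  refine ⟨η₁, hη₁, ?_⟩
  intro σ hσ hσ' a₀ θ₀ u₀ ha₀ hθ₀ hu₀ ha₀0 hθ₀0 T N Φ ρ θ u hE hpack s s' hs hss' hs'T
  have hU : UniqueDiffOn ℝ (Ico (0 : ℝ) T) := uniqueDiffOn_Ico 0 T
  /- ── the two currents `Y⊥` (fast kinetic) and `X` (collisional counter-terms) of the statement ── -/
  set Yp : ℝ → T3 × V3 → ℝ := fun r y =>
    (θ r y.1)⁻¹ * ∑ j : Fin 3, ∑ k : Fin 3, ((y.2 - u r y.1) j * (y.2 - u r y.1) k -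
        (if j = k then ‖y.2 - u r y.1‖ ^ 2 / 3 else 0)) * Torus.partialDeriv k (fun y' => u r y' j) y.1 +
      (‖y.2 - u r y.1‖ ^ 2 - 5 * θ r y.1) *
        (∑ k : Fin 3, (y.2 - u r y.1) k * Torus.partialDeriv k (θ r) y.1) / (2 * (θ r y.1) ^ 2) with hYp
  set Xc : ℝ → T3 × V3 → ℝ := fun r y =>
    (∑ k : Fin 3, Torus.partialDeriv k (fun y' => u r y' k / θ r y') y.1) *
        (θ r y.1 * (ρ r y.1 * σ ^ 3) * deriv hsCompressibility (ρ r y.1 * σ ^ 3) +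
          (1 / 3) * (hsCompressibility (ρ r y.1 * σ ^ 3) - 1) * ‖y.2 - u r y.1‖ ^ 2) +
      ((∑ k : Fin 3, u r y.1 k * Torus.partialDeriv k (θ r) y.1) / (θ r y.1) ^ 2) *
        (θ r y.1 * (ρ r y.1 * σ ^ 3) * deriv hsCompressibility (ρ r y.1 * σ ^ 3) +
          (1 / 3) * (hsCompressibility (ρ r y.1 * σ ^ 3) - 1) * ‖y.2 - u r y.1‖ ^ 2) +
      (hsCompressibility (ρ r y.1 * σ ^ 3) - 1) *
        (∑ k : Fin 3, (y.2 - u r y.1) k * Torus.partialDeriv k (θ r) y.1) / θ r y.1 with hXc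
  have hIcc : Icc s s' ⊆ Ico 0 T := fun r hr => ⟨hs.trans hr.1, hr.2.trans_lt hs'T⟩
  /- ── the EOS data on the band ── -/
  have hZ : ∀ η ∈ Ioo 0 η₁, hsCompressibility η = 1 + η * deriv F η := by
    intro η hη
    have hev : hsExcessFreeEnergy =ᶠ[𝓝 η] F :=
      eventuallyEq_of_mem (isOpen_Ioo.mem_nhds hη) fun z hz => hFeq ⟨hz.1.le, hz.2⟩
    rw [hsCompressibility, hev.deriv_eq]
  have hRf : ∀ η ∈ Ioo 0 η₁, 0 < Rf η ∧ DifferentiableAt ℝ (fun x => Real.log (Rf x)) η ∧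
      deriv (fun x => Real.log (Rf x)) η = 2 * deriv F η + η * deriv (deriv F) η := fun η hη =>
    ⟨(hsol η ⟨by linarith [hη.1], hη.2.trans_le hη₁r⟩).1, hdiff η hη⟩
  have hband : ∀ t ∈ Ico 0 T, ∀ x, ρ t x * σ ^ 3 ∈ Ioo 0 η₁ := fun t ht x =>
    ⟨mul_pos (hE.density_pos t ht x) (pow_pos hσ 3), hpack t ht x⟩
  /- ── (1) the pointwise cancellation `Dg = Y⊥ − X` on `[0, T)` ── -/
  have hcancel := ClampedCurrentsDockCancellation.stub_cancellation σ T η₁ ρ θ u F Rf hE hσ hη₁ hFan hZ hRf hband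
  have hpt : ∀ t ∈ Ico 0 T, ∀ y : T3 × V3,
      DgExp T (fun t x => ρ t x * Rf (σ ^ 3 * ρ t x)) θ u t y = Yp t y - Xc t y := by
    intro t ht y
    have h := hcancel t ht y.1 y.2
    dsimp only at h
    simp only [DgExp, gExp, hYp, hXc]
    linear_combination h
  /- ── (2) `Z`, `Z′` are continuous on the band ── -/
  have hFan' : AnalyticOnNhd ℝ (fun η => 1 + η * deriv F η) (Ioo 0 η₁) := fun η hη =>
    analyticAt_const.fun_add (analyticAt_id.fun_mul (hFan.deriv η ⟨by linarith [hη.1], hη.2⟩))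
  have hZs : ContDiffOn ℝ (⊤ : ℕ∞) hsCompressibility (Ioo 0 η₁) :=
    hFan'.contDiffOn_of_completeSpace.congr fun η hη => hZ η hη
  have hZc : ContinuousOn hsCompressibility (Ioo 0 η₁) := hZs.continuousOn
  have hZ'c : ContinuousOn (deriv hsCompressibility) (Ioo 0 η₁) :=
    hZs.continuousOn_deriv_of_isOpen isOpen_Ioo (by simp)
  /- ── (3) the clamped coefficient fields are continuous on `ℝ × 𝕋³` ── -/
  set c : ℝ → ℝ := fun t => max s (min t s') with hc_def
  have hcm : ∀ t, c t ∈ Ico 0 T := fun t =>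
    ⟨hs.trans (le_max_left _ _), (max_le hss' (min_le_right _ _)).trans_lt hs'T⟩
  have hcr : ∀ r ∈ Icc s s', c r = r := fun r hr => by
    simp only [hc_def, min_eq_left hr.2, max_eq_right hr.1]
  have hΘc : Continuous fun p : ℝ × T3 => θ (c p.1) p.2 :=
    continuous_clamp hE.smooth_temperature.continuousOn_stLift hs hss' hs'T
  have hUc : Continuous fun p : ℝ × T3 => u (c p.1) p.2 :=
    continuous_clamp hE.smooth_velocity.continuousOn_stLift hs hss' hs'T
  have hPc : Continuous fun p : ℝ × T3 => ρ (c p.1) p.2 :=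
    continuous_clamp hE.smooth_density.continuousOn_stLift hs hss' hs'T
  have hdΘ : ∀ k, Continuous fun p : ℝ × T3 => Torus.partialDeriv k (θ (c p.1)) p.2 := fun k =>
    continuous_clamp (hE.smooth_temperature.partialDeriv hU k).continuousOn_stLift hs hss' hs'T
  have hdU : ∀ k j, Continuous fun p : ℝ × T3 => Torus.partialDeriv k (fun y => u (c p.1) y j) p.2 :=
    fun k j => continuous_clamp ((hE.smooth_velocity.apply j).partialDeriv hU k).continuousOn_stLift hs hss' hs'T
  have hQ : ∀ k, Torus.IsSmoothSpaceTimeOn (Ico 0 T) (fun t y => u t y k / θ t y) := fun k =>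
    ContDiffOn.div (hE.smooth_velocity.apply k) hE.smooth_temperature fun p hp =>
      (hE.temperature_pos p.1 (mem_prod.1 hp).1 _).ne'
  have hdQ : ∀ k, Continuous fun p : ℝ × T3 =>
      Torus.partialDeriv k (fun y => u (c p.1) y k / θ (c p.1) y) p.2 := fun k =>
    continuous_clamp ((hQ k).partialDeriv hU k).continuousOn_stLift hs hss' hs'T
  have hbandc : ∀ p : ℝ × T3, ρ (c p.1) p.2 * σ ^ 3 ∈ Ioo 0 η₁ := fun p => hband _ (hcm p.1) _
  have hZcc : Continuous fun p : ℝ × T3 => hsCompressibility (ρ (c p.1) p.2 * σ ^ 3) :=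
    hZc.comp_continuous (hPc.mul continuous_const) hbandc
  have hZ'cc : Continuous fun p : ℝ × T3 => deriv hsCompressibility (ρ (c p.1) p.2 * σ ^ 3) :=
    hZ'c.comp_continuous (hPc.mul continuous_const) hbandc
  have hΘ0 : ∀ p : ℝ × T3, θ (c p.1) p.2 ≠ 0 := fun p => (hE.temperature_pos _ (hcm p.1) _).ne'
  /- ── (4) the clamped currents: measurable, of cubic growth on the window, hence integrable along `Λ` ── -/
  set GY : ℝ × (T3 × V3) → ℝ := fun q => Yp (c q.1) q.2 with hGY
  set GX : ℝ × (T3 × V3) → ℝ := fun q => Xc (c q.1) q.2 with hGX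
  have hGYm : Measurable GY :=
    (continuous_Y_aux (Θc := fun p => θ (c p.1) p.2) (Uc := fun p => u (c p.1) p.2)
      (dΘ := fun k p => Torus.partialDeriv k (θ (c p.1)) p.2)
      (dU := fun k j p => Torus.partialDeriv k (fun y => u (c p.1) y j) p.2) hΘc hUc hdΘ hdU hΘ0).measurable
  have hGXm : Measurable GX :=
    (continuous_X_aux (σ := σ) (Θc := fun p => θ (c p.1) p.2) (Pc := fun p => ρ (c p.1) p.2)
      (Zc := fun p => hsCompressibility (ρ (c p.1) p.2 * σ ^ 3))
      (Z'c := fun p => deriv hsCompressibility (ρ (c p.1) p.2 * σ ^ 3)) (Uc := fun p => u (c p.1) p.2)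
      (dΘ := fun k p => Torus.partialDeriv k (θ (c p.1)) p.2)
      (dQ := fun k p => Torus.partialDeriv k (fun y => u (c p.1) y k / θ (c p.1) y) p.2)
      hΘc hPc hZcc hZ'cc hUc hdΘ hdQ hΘ0).measurable
  obtain ⟨CY, hCY0, hCY⟩ := exists_abs_Y_le (Θc := fun p => θ (c p.1) p.2) (Uc := fun p => u (c p.1) p.2)
      (dΘ := fun k p => Torus.partialDeriv k (θ (c p.1)) p.2)
      (dU := fun k j p => Torus.partialDeriv k (fun y => u (c p.1) y j) p.2) hΘc hUc hdΘ hdU hΘ0 s s'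
  obtain ⟨CX, hCX0, hCX⟩ := exists_abs_X_le (σ := σ) (Θc := fun p => θ (c p.1) p.2)
      (Pc := fun p => ρ (c p.1) p.2) (Zc := fun p => hsCompressibility (ρ (c p.1) p.2 * σ ^ 3))
      (Z'c := fun p => deriv hsCompressibility (ρ (c p.1) p.2 * σ ^ 3)) (Uc := fun p => u (c p.1) p.2)
      (dΘ := fun k p => Torus.partialDeriv k (θ (c p.1)) p.2)
      (dQ := fun k p => Torus.partialDeriv k (fun y => u (c p.1) y k / θ (c p.1) y) p.2)
      hΘc hPc hZcc hZ'cc hUc hdΘ hdQ hΘ0 s s'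
  have hIY := integrable_window_functional (G := GY) hσ hσ' ha₀ hθ₀ hu₀ ha₀0 hθ₀0 Φ hGYm hss' hCY0
    (fun r hr y => hCY r hr y.1 y.2)
  have hIX := integrable_window_functional (G := GX) hσ hσ' ha₀ hθ₀ hu₀ ha₀0 hθ₀0 Φ hGXm hss' hCX0
    (fun r hr y => hCX r hr y.1 y.2)
  /- ── (5) the two window functionals of the statement ── -/
  have hYcongr : ∀ p : Config (N + 1) (Fin 3) T3 × (ℕ → V3),
      (∫ r in s..s', ∑ i, GY (r, lambertFlow (Torus.geometry (Fin 3)) (hsDiameter σ N) p.2 p.1 r i)) =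
        ∫ r in s..s', ∑ i, Yp r (lambertFlow (Torus.geometry (Fin 3)) (hsDiameter σ N) p.2 p.1 r i) := by
    intro p
    refine intervalIntegral.integral_congr fun r hr => ?_
    rw [uIcc_of_le hss'] at hr
    simp only [hGY, hcr r hr]
  have hXcongr : ∀ p : Config (N + 1) (Fin 3) T3 × (ℕ → V3),
      (∫ r in s..s', ∑ i, GX (r, lambertFlow (Torus.geometry (Fin 3)) (hsDiameter σ N) p.2 p.1 r i)) =
        ∫ r in s..s', ∑ i, Xc r (lambertFlow (Torus.geometry (Fin 3)) (hsDiameter σ N) p.2 p.1 r i) := by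
    intro p
    refine intervalIntegral.integral_congr fun r hr => ?_
    rw [uIcc_of_le hss'] at hr
    simp only [hGX, hcr r hr]
  have H1 : Integrable (fun p : Config (N + 1) (Fin 3) T3 × (ℕ → V3) =>
      ∫ r in s..s', ∑ i, Yp r (lambertFlow (Torus.geometry (Fin 3)) (hsDiameter σ N) p.2 p.1 r i))
      ((localGibbsLaw σ a₀ u₀ θ₀ N Φ).prod (lambertNoise (Fin 3))) :=
    hIY.2.1.congr (Eventually.of_forall hYcongr)
  have H2 : Integrable (fun p : Config (N + 1) (Fin 3) T3 × (ℕ → V3) =>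
      ∫ r in s..s', ∑ i, Xc r (lambertFlow (Torus.geometry (Fin 3)) (hsDiameter σ N) p.2 p.1 r i))
      ((localGibbsLaw σ a₀ u₀ θ₀ N Φ).prod (lambertNoise (Fin 3))) :=
    hIX.2.1.congr (Eventually.of_forall hXcongr)
  /- ── (6) the split of the streaming functional ── -/
  have H3 : (∫ p, (∫ r in s..s', DgSum T (fun r x => ρ r x * Rf (σ ^ 3 * ρ r x)) θ u r
      (lambertFlow (Torus.geometry (Fin 3)) (hsDiameter σ N) p.2 p.1 r))
        ∂((localGibbsLaw σ a₀ u₀ θ₀ N Φ).prod (lambertNoise (Fin 3)))) =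
      (∫ p, (∫ r in s..s', ∑ i, Yp r (lambertFlow (Torus.geometry (Fin 3)) (hsDiameter σ N) p.2 p.1 r i))
        ∂((localGibbsLaw σ a₀ u₀ θ₀ N Φ).prod (lambertNoise (Fin 3)))) -
      (∫ p, (∫ r in s..s', ∑ i, Xc r (lambertFlow (Torus.geometry (Fin 3)) (hsDiameter σ N) p.2 p.1 r i))
        ∂((localGibbsLaw σ a₀ u₀ θ₀ N Φ).prod (lambertNoise (Fin 3)))) := by
    rw [← integral_sub H1 H2]
    refine integral_congr_ae ?_
    filter_upwards [hIY.2.2, hIX.2.2] with p hpY hpX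
    have hY' : IntervalIntegrable
        (fun r => ∑ i, Yp r (lambertFlow (Torus.geometry (Fin 3)) (hsDiameter σ N) p.2 p.1 r i))
        volume s s' := by
      rw [intervalIntegrable_iff_integrableOn_Ioc_of_le hss']
      exact hpY.congr_fun (fun r hr => by simp only [hGY, hcr r (Ioc_subset_Icc_self hr)]) measurableSet_Ioc
    have hX' : IntervalIntegrable
        (fun r => ∑ i, Xc r (lambertFlow (Torus.geometry (Fin 3)) (hsDiameter σ N) p.2 p.1 r i))
        volume s s' := by
      rw [intervalIntegrable_iff_integrableOn_Ioc_of_le hss']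
      exact hpX.congr_fun (fun r hr => by simp only [hGX, hcr r (Ioc_subset_Icc_self hr)]) measurableSet_Ioc
    rw [← intervalIntegral.integral_sub hY' hX']
    refine intervalIntegral.integral_congr fun r hr => ?_
    rw [uIcc_of_le hss'] at hr
    simp only [DgSum, ← Finset.sum_sub_distrib]
    exact Finset.sum_congr rfl fun i _ => hpt r (hIcc hr) _
  exact ⟨H1, H2, H3⟩

end Stub

end Summit.AtomisticToContinuum.HydrodynamicLimit.Theorems.LambertianContactSwapLambertianEulerProductionSplit

end
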